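import Summits.ABC.ABC.Theorems.EisensteinQuarantine.Negative.EisensteinQuarantineFalseOfForcedPairDegreeDepthLaw
import Summits.ABC.ABC.Theorems.EisensteinQuarantine.Negative.EisensteinQuarantineFalseOfForcedPairXiDvd
import Literature.NumberTheory.EllipticCurves.NewformsOrthogonalProofs
import Literature.NumberTheory.EllipticCurves.CongruenceNumber
import Literature.NumberTheory.EllipticCurves.ModularSymbolsLattice
import HarnessLib

/-!
# The ARS congruence-number currency of the research stub `stub_forcedPairOccurrence` (crux `EisensteinQuarantine`,
# stmt-ABC-15023, line `forced-pair-dlog`), and its old-lattice EXHIBIT form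

Helper file (`--supports stmt-ABC-15023 --as helper`) written by the stub-plan prover of `stub_forcedPairOccurrence`
(STUB-PLAN-stub_forcedPairOccurrence.md, Step 1: ideator k2's A3 + the critic's S1/A4, `PlanRA`).  The sibling file
`EisensteinQuarantineFalseOfForcedPairDegreeDepthLaw.lean` (p135429) moved the stub to OPTIMAL MODULAR DEGREES by
Takahashi's Thm 2.3; this file moves it one step further, to the congruence number `r = congruenceNumber P.f` of the
newform in `S₂(Γ₀(N), ℤ)` (Agashe–Ribet–Stein 2012 §2.1), the X₀(N)-side twin of the Brandt-side stub
(`ψ ↔ g`, `⟨·,·⟩_w ↔` Petersson), and records the one currency in which ONE EXHIBITED integral, non-eigen form closes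
everything:

* `ForcedPairCongruenceDepthLaw` — `2^{v₂(q−1)} · ordProj[2] c_ℓ(W) ≤ 2^c · ordProj[2] r(P.f)` at forced pairs;
  `degreeDepthLaw_of_congruenceDepthLaw` under the named fact `padicValNat_congruenceNumber_eq_of_not_sq_dvd`
  (ARS Thm 2.1(2): `ord_p r = ord_p deg` when `p² ∤ N`; here `p = 2` and `4 ∤ N`, `not_four_dvd_conductorNorm_of_legendrePoint`);
  then p135429: `forcedPairDepthLaw_of_congruenceDepthLaw` (and p134266 `EisensteinQuarantine_false_of_ForcedPairDepthLaw`
  refutes the crux from it; the two-line composition is left to the Negative/ lane).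
* `dvd_congruenceNumber_of_oldform_congruence` (PROVED): a congruence `f − g = r • h` between a NEW form `f ≠ 0` and an
  integral OLD form `g` forces `r ∣ congruenceNumber f` — `new ⊥ old` (`newSubspace0_le_orthogonal_oldSubspace0`) + ARS
  (i) ⇒ (ii) (`dvd_congruenceNumber_of_sub_eq_smul`), both landed.
* `ForcedPairOldLatticeProximity` — the EXHIBIT form (research): `P.f ≡` an integral OLD form modulo
  `2^{v₂(q−1) + v₂ c_ℓ(W) − c}`; with positivity of `r` (displayed hypothesis, ARS §2.1) it gives the congruence law
  (`congruenceDepthLaw_of_oldLatticeProximity`, `forcedPairDepthLaw_of_oldLatticeProximity`).  Resource behind it: the cokernel of the degeneracy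
  map on `H₁(X₀(N), ℤ)` is supported at Eisenstein maximal ideals (Diamond–Ribet 1997 p. 439) — the old lattice is
  non-saturated exactly at the 2-Eisenstein ideal of the forced family.

Nothing here is a lower bound by itself; the displayed named facts (`takahashi2001_thm_2_3`, ARS Thm 2.1(2),
positivity of `r_E`) and the route item `FreyModularity` (stmt-ABC-11340) are all theorems in print.

## References

* [AgasheRibetStein2012] A. Agashe, K. Ribet, W. Stein, The modular degree, congruence primes, and multiplicity one
  (2012), §2.1, Thm 2.1.
* [Takahashi2001] S. Takahashi, J. Number Theory 90 (2001), Thm. 2.3 (p. 79).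
* [DiamondRibet1997] F. Diamond, K. Ribet, in Cornell–Silverman–Stevens (1997), p. 435 (Lemma 4.4), p. 439.
-/

-- `Summit.<Summit>.<Problem>`: for the single-conjunct summit `ABC` the duplicate `ABC.ABC` is mandated.
set_option linter.dupNamespace false

noncomputable section

open scoped BigOperators
open Literature.NumberTheory.Automorphic Literature.NumberTheory.EllipticCurves
open Literature.NumberTheory.EllipticCurves.ModularForms

namespace Summit.ABC.ABC.Theorems

open Summit.ABC.ABC.Theorems.EisensteinQuarantine.Negative

/-! ## The congruence-number law and its reduction to the degree law -/

/-- **Hypothesis `ForcedPairCongruenceDepthLaw` — the forced-pair depth law for CONGRUENCE NUMBERS (research statement,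
NOT proved, NOT in print).**  As `ForcedPairDegreeDepthLaw` (p135429) with the optimal modular degree replaced by the
congruence number `r = congruenceNumber P.f` of the newform (ARS 2012 §2.1: the largest `r` with `f ≡ g (mod r)` for some
integral cusp form `g` Petersson-orthogonal to `f`): at every forced pair `(q, ℓ)`, for every elliptic `W/ℚ` with the
`a`-sequence of `E_(−ℓ,ℓ−1)` and every newform-minimal datum `P` of `W` at level `N`,
`2^{v₂(q−1)} · ordProj[2] c_ℓ(W) ≤ 2^c · ordProj[2] r(P.f)`.  This is the X₀(N)-side twin of the registered stub
(`ψ ↔ g`, `⟨·,·⟩_w ↔` Petersson); it implies `ForcedPairDegreeDepthLaw` under ARS Thm 2.1(2)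
(`degreeDepthLaw_of_congruenceDepthLaw`).  HYPOTHESIS; not a Literature fact. -/
def ForcedPairCongruenceDepthLaw : Prop :=
  ∃ c : ℕ, ∀ q ℓ : ℕ, q.Prime → ℓ.Prime → q ≠ 2 → 32 * q ∣ ℓ - 1 →
    ∀ (N : ℕ) [NeZero N], (freyCurve (-(ℓ : ℤ)) ((ℓ - 1 : ℕ) : ℤ)).conductorNorm ℤ = N →
    ∀ (W : WeierstrassCurve ℚ) [W.IsElliptic] (P : ModularParametrizationData W N),
      (∀ n : ℕ, W.LFunction n = (freyCurve (-(ℓ : ℤ)) ((ℓ - 1 : ℕ) : ℤ)).LFunction n) →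
      (∀ (W' : WeierstrassCurve ℚ) [W'.IsElliptic] (P' : ModularParametrizationData W' N),
          P'.f = P.f → P.modularDegree ≤ P'.modularDegree) →
      2 ^ ((q - 1).factorization 2) * ordProj[2] ((W.minimalDiscriminantNorm ℤ).factorization ℓ) ≤
        2 ^ c * ordProj[2] (congruenceNumber P.f)

/-- **The forced conductor is not divisible by `4`**: at a Legendre point `(−ℓ, ℓ−1)` with `ℓ` prime and `32 ∣ ℓ − 1`
the Frey curve is Serre-normalised (`−ℓ ≡ −1 (mod 4)`, `32 ∣ ℓ − 1`), hence semistable at `2`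
(`freyCurve_serre_semistable`; `N = rad(ℓ(ℓ−1))`). [folklore] -/
theorem not_four_dvd_conductorNorm_of_legendrePoint {ℓ N : ℕ} (hℓ : ℓ.Prime) (h32 : 32 ∣ ℓ - 1)
    (hN : (freyCurve (-(ℓ : ℤ)) ((ℓ - 1 : ℕ) : ℤ)).conductorNorm ℤ = N) : ¬ 2 ^ 2 ∣ N := by
  have hℓ1 : 1 ≤ ℓ := hℓ.one_lt.le
  have hM0 : ℓ - 1 ≠ 0 := by have := hℓ.two_le; omega
  have hℓcast : (ℓ : ℤ) = ((ℓ - 1 : ℕ) : ℤ) + 1 := by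
    rw [Nat.cast_sub hℓ1]; push_cast; ring
  have hsum : -(ℓ : ℤ) + ((ℓ - 1 : ℕ) : ℤ) = -1 := by rw [hℓcast]; ring
  have habc : (-(ℓ : ℤ)) * ((ℓ - 1 : ℕ) : ℤ) * (-(ℓ : ℤ) + ((ℓ - 1 : ℕ) : ℤ)) =
      ((ℓ * (ℓ - 1) : ℕ) : ℤ) := by
    rw [hsum]; push_cast; ring
  have h0 : (-(ℓ : ℤ)) * ((ℓ - 1 : ℕ) : ℤ) * (-(ℓ : ℤ) + ((ℓ - 1 : ℕ) : ℤ)) ≠ 0 := by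
    rw [habc]; exact_mod_cast Nat.mul_ne_zero hℓ.ne_zero hM0
  have hab : IsCoprime (-(ℓ : ℤ)) ((ℓ - 1 : ℕ) : ℤ) := by
    rw [IsCoprime.neg_left_iff, Int.isCoprime_iff_gcd_eq_one, Int.gcd_natCast_natCast]
    exact (Nat.coprime_self_sub_right hℓ1).mpr (Nat.coprime_one_right ℓ)
  have ha4 : (-(ℓ : ℤ)) ≡ -1 [ZMOD 4] := by
    have h4 : (4 : ℤ) ∣ ((ℓ - 1 : ℕ) : ℤ) := by exact_mod_cast (show (4 : ℕ) ∣ 32 by norm_num).trans h32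
    have : (-(ℓ : ℤ)) = -1 - ((ℓ - 1 : ℕ) : ℤ) := by rw [hℓcast]; ring
    rw [this]
    calc -1 - ((ℓ - 1 : ℕ) : ℤ) ≡ -1 - 0 [ZMOD 4] :=
          Int.ModEq.sub_left _ ((Int.modEq_zero_iff_dvd).mpr h4)
      _ = -1 := by ring
  have hb32 : (32 : ℤ) ∣ ((ℓ - 1 : ℕ) : ℤ) := by exact_mod_cast h32
  rw [← hN]
  exact freyCurve_serre_semistable hab h0 ha4 hb32 2 Nat.prime_two

/-- **`ForcedPairCongruenceDepthLaw → ForcedPairDegreeDepthLaw`** under the named fact ARS 2012 Thm 2.1(2)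
(`padicValNat_congruenceNumber_eq_of_not_sq_dvd`: `ord_p r = ord_p deg` for the optimal datum when `p² ∤ N`; here `p = 2`
and `4 ∤ N` by `not_four_dvd_conductorNorm_of_legendrePoint`). [cite: AgasheRibetStein2012, Thm. 2.1] -/
theorem degreeDepthLaw_of_congruenceDepthLaw (hARS : padicValNat_congruenceNumber_eq_of_not_sq_dvd)
    (h : ForcedPairCongruenceDepthLaw) : ForcedPairDegreeDepthLaw := by
  obtain ⟨c, hc⟩ := h
  refine ⟨c, fun q ℓ hq hℓ hq2 h32 N _ hN W _ P hLf hmin => ?_⟩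
  have h4 : ¬ 2 ^ 2 ∣ N :=
    not_four_dvd_conductorNorm_of_legendrePoint hℓ ((Dvd.intro q rfl).trans h32) hN
  have hv : padicValNat 2 (congruenceNumber P.f) = padicValNat 2 P.modularDegree :=
    hARS W N P hmin 2 Nat.prime_two h4
  have hproj : ordProj[2] (congruenceNumber P.f) = ordProj[2] P.modularDegree := by
    rw [Nat.factorization_def _ Nat.prime_two, Nat.factorization_def _ Nat.prime_two, hv]
  rw [← hproj]
  exact hc q ℓ hq hℓ hq2 h32 N hN W P hLf hmin

/-- **ARS + Takahashi + modularity: the congruence-number law ⟹ the Brandt valuation law `ForcedPairDepthLaw`**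
(p135429 `forcedPairDepthLaw_of_degreeDepthLaw` after `degreeDepthLaw_of_congruenceDepthLaw`).
[cite: AgasheRibetStein2012, Thm. 2.1] -/
theorem forcedPairDepthLaw_of_congruenceDepthLaw (hARS : padicValNat_congruenceNumber_eq_of_not_sq_dvd)
    (hT : takahashi2001_thm_2_3) (hMod : Summit.ABC.ABC.Theses.DefiniteXi.FreyModularity)
    (h : ForcedPairCongruenceDepthLaw) : ForcedPairDepthLaw :=
  forcedPairDepthLaw_of_degreeDepthLaw hT hMod (degreeDepthLaw_of_congruenceDepthLaw hARS h)

/-! ## The EXHIBIT form: proximity of `f_E` to the integral old lattice -/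

/-- **One exhibited congruence with an integral OLD form bounds the congruence number from below**: if `f ≠ 0` is NEW
at level `N`, `g` is old and integral, `h` is integral and `f − g = r • h`, then `r ∣ congruenceNumber f` — `new ⊥ old`
(`newSubspace0_le_orthogonal_oldSubspace0`, landed) puts `g` in the integral orthogonal complement of `f`, and ARS (i) ⇒ (ii)
(`dvd_congruenceNumber_of_sub_eq_smul`, landed) does the rest. [cite: AgasheRibetStein2012, §2.1] -/
theorem dvd_congruenceNumber_of_oldform_congruence {N : ℕ} [NeZero N]
    {f g h : CuspForm (CongruenceSubgroup.Gamma0 N) 2} (hf : f ∈ newSubspace0 N 2) (hf0 : f ≠ 0)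
    (hg : g ∈ oldSubspace0 N 2) (hgi : g ∈ integralCuspForms0 N 2)
    (hh : h ∈ integralCuspForms0 N 2) {r : ℕ} (hfg : f - g = r • h) :
    r ∣ congruenceNumber f :=
  dvd_congruenceNumber_of_sub_eq_smul hf0
    (mem_integralOrthogonal0.mpr ⟨hgi, newSubspace0_le_orthogonal_oldSubspace0 N 2 hf g hg⟩) hh hfg

/-- **Hypothesis `ForcedPairOldLatticeProximity` — the EXHIBIT form of the congruence-number currency (research
statement, NOT proved, NOT in print).**  At every forced pair `(q, ℓ)` the newform `P.f` of every curve `W` with the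
`a`-sequence of `E_(−ℓ,ℓ−1)` is congruent, modulo `2^{v₂(q−1) + v₂ c_ℓ(W) − c}`, to an integral OLD form of level `N`:
`P.f − g = 2^{…} • h` with `g ∈ oldSubspace0 N 2` integral and `h` integral.  Candidate mechanism: Mazur's level-`q`
2-Eisenstein cluster (index `num((q−1)/12) ⊇ 2^{v₂(q−1)−2}`) raised through `ℓ ≡ 1 (mod 2^j q)`, landing in the old lattice,
whose non-saturation in `S₂(Γ₀(N), ℤ)` is supported at Eisenstein maximal ideals (Diamond–Ribet 1997, p. 439).  Strictly
STRONGER than `ForcedPairCongruenceDepthLaw` given positivity of the congruence numbers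
(`congruenceDepthLaw_of_oldLatticeProximity`).  HYPOTHESIS; not a Literature fact. -/
def ForcedPairOldLatticeProximity : Prop :=
  ∃ c : ℕ, ∀ q ℓ : ℕ, q.Prime → ℓ.Prime → q ≠ 2 → 32 * q ∣ ℓ - 1 →
    ∀ (N : ℕ) [NeZero N], (freyCurve (-(ℓ : ℤ)) ((ℓ - 1 : ℕ) : ℤ)).conductorNorm ℤ = N →
    ∀ (W : WeierstrassCurve ℚ) [W.IsElliptic] (P : ModularParametrizationData W N),
      (∀ n : ℕ, W.LFunction n = (freyCurve (-(ℓ : ℤ)) ((ℓ - 1 : ℕ) : ℤ)).LFunction n) →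
      ∃ g h : CuspForm (CongruenceSubgroup.Gamma0 N) 2,
        g ∈ oldSubspace0 N 2 ∧ g ∈ integralCuspForms0 N 2 ∧ h ∈ integralCuspForms0 N 2 ∧
        P.f - g = (2 ^ ((q - 1).factorization 2
                    + (((W.minimalDiscriminantNorm ℤ).factorization ℓ).factorization 2) - c) : ℕ) • h

/-- **Positivity of `r` + `ForcedPairOldLatticeProximity ⟹ ForcedPairCongruenceDepthLaw`** (same `c`): the exhibited
congruence gives `2^{j + v₂ c_ℓ(W) − c} ∣ r(P.f)` (`dvd_congruenceNumber_of_oldform_congruence` with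
`P.isNewformOf.1.1 : P.f ∈ newSubspace0 N 2` and `IsNewform0.ne_zero`), and `r(P.f) > 0` turns the divisibility into
`2^j · ordProj[2] c_ℓ(W) ≤ 2^c · ordProj[2] r(P.f)`.  The displayed hypothesis `hpos` is the positivity of the congruence
number of the newform of an elliptic curve (ARS 2012 §2.1 "the positive integer `r_E`": the quotient
`S₂(Γ₀(N); ℤ)/(ℤf + (ℤf)^⊥)` is finite; the tree's `congruenceNumber` is a `Nat.card` with junk value `0`; in the tree so
far only as hypothesis (b) of `SameLevelCongruenceFacts`). [cite: AgasheRibetStein2012, §2.1] -/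
theorem congruenceDepthLaw_of_oldLatticeProximity
    (hpos : ∀ (W : WeierstrassCurve ℚ) [W.IsElliptic] (N : ℕ) [NeZero N] (D : ModularParametrizationData W N),
      0 < congruenceNumber D.f)
    (h : ForcedPairOldLatticeProximity) : ForcedPairCongruenceDepthLaw := by
  obtain ⟨c, hc⟩ := h
  refine ⟨c, fun q ℓ hq hℓ hq2 h32 N _ hN W _ P hLf _ => ?_⟩
  obtain ⟨g, h, hg, hgi, hh, hfg⟩ := hc q ℓ hq hℓ hq2 h32 N hN W P hLf
  have hr : 0 < congruenceNumber P.f := hpos W N P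
  have hdvd : 2 ^ ((q - 1).factorization 2
      + (((W.minimalDiscriminantNorm ℤ).factorization ℓ).factorization 2) - c) ∣ congruenceNumber P.f :=
    dvd_congruenceNumber_of_oldform_congruence P.isNewformOf.1.1 (IsNewform0.ne_zero P.isNewformOf.1)
      hg hgi hh hfg
  have hle : (q - 1).factorization 2
      + ((W.minimalDiscriminantNorm ℤ).factorization ℓ).factorization 2 - c
        ≤ (congruenceNumber P.f).factorization 2 :=
    (Nat.prime_two.pow_dvd_iff_le_factorization hr.ne').mp hdvd
  calc 2 ^ (q - 1).factorization 2 * ordProj[2] ((W.minimalDiscriminantNorm ℤ).factorization ℓ)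
      = 2 ^ ((q - 1).factorization 2
          + ((W.minimalDiscriminantNorm ℤ).factorization ℓ).factorization 2) := by rw [pow_add]
    _ ≤ 2 ^ (c + (congruenceNumber P.f).factorization 2) :=
        Nat.pow_le_pow_right (by norm_num) (by omega)
    _ = 2 ^ c * ordProj[2] (congruenceNumber P.f) := by rw [pow_add]

/-- **Positivity of `r` + ARS + Takahashi + modularity: the old-lattice proximity law ⟹ `ForcedPairDepthLaw`** (hence
`¬ EisensteinQuarantine` by p134266).  All displayed facts are TRUE in print; `FreyModularity` is route item stmt-ABC-11340.
[cite: AgasheRibetStein2012, §2.1] -/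
theorem forcedPairDepthLaw_of_oldLatticeProximity
    (hpos : ∀ (W : WeierstrassCurve ℚ) [W.IsElliptic] (N : ℕ) [NeZero N] (D : ModularParametrizationData W N),
      0 < congruenceNumber D.f)
    (hARS : padicValNat_congruenceNumber_eq_of_not_sq_dvd) (hT : takahashi2001_thm_2_3)
    (hMod : Summit.ABC.ABC.Theses.DefiniteXi.FreyModularity) (h : ForcedPairOldLatticeProximity) :
    ForcedPairDepthLaw :=
  forcedPairDepthLaw_of_congruenceDepthLaw hARS hT hMod (congruenceDepthLaw_of_oldLatticeProximity hpos h)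

/-! ## The congruence-number currency pays the registered stub (appended 2026-08-17, after p173946) -/

/-- **ARS + Takahashi + modularity: the congruence-number law ⟹ the registered stub** (`ForcedPairOccurrence`, verbatim
`stub_forcedPairOccurrence`; with `c ↦ c + 2`), composing `forcedPairDepthLaw_of_congruenceDepthLaw` with the landed
`forcedPairOccurrence_of_forcedPairDepthLaw` (p173946). [cite: AgasheRibetStein2012, Thm. 2.1] -/
theorem forcedPairOccurrence_of_congruenceDepthLaw (hARS : padicValNat_congruenceNumber_eq_of_not_sq_dvd)
    (hT : takahashi2001_thm_2_3) (hMod : Summit.ABC.ABC.Theses.DefiniteXi.FreyModularity)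
    (h : ForcedPairCongruenceDepthLaw) : ForcedPairOccurrence :=
  forcedPairOccurrence_of_forcedPairDepthLaw (forcedPairDepthLaw_of_congruenceDepthLaw hARS hT hMod h)

/-- **Positivity of `r` + ARS + Takahashi + modularity: ONE exhibited congruence of `f_E` with an integral old form per
forced pair (`ForcedPairOldLatticeProximity`) ⟹ the registered stub** — the R-A exhibit chain of the stub plan, end to end,
by name. [cite: AgasheRibetStein2012, §2.1] -/
theorem forcedPairOccurrence_of_oldLatticeProximity
    (hpos : ∀ (W : WeierstrassCurve ℚ) [W.IsElliptic] (N : ℕ) [NeZero N] (D : ModularParametrizationData W N),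
      0 < congruenceNumber D.f)
    (hARS : padicValNat_congruenceNumber_eq_of_not_sq_dvd) (hT : takahashi2001_thm_2_3)
    (hMod : Summit.ABC.ABC.Theses.DefiniteXi.FreyModularity) (h : ForcedPairOldLatticeProximity) :
    ForcedPairOccurrence :=
  forcedPairOccurrence_of_forcedPairDepthLaw (forcedPairDepthLaw_of_oldLatticeProximity hpos hARS hT hMod h)

end Summit.ABC.ABC.Theorems

end
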